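import Mathlib.Analysis.CStarAlgebra.Matrix
import Mathlib.Analysis.InnerProductSpace.Calculus
import Mathlib.Analysis.SpecialFunctions.Exponential
import Mathlib.Analysis.SpecialFunctions.ExpDeriv
import Mathlib.Analysis.Calculus.Deriv.MeanValue
import Mathlib.Analysis.Complex.RealDeriv
import Mathlib.LinearAlgebra.Matrix.Hermitian

/-!
# Semigroup bounds from the numerical range (helpers for `DaviesGaffneyWilson`, stmt-QuantumFields-8873)

Route `QuantumFields/QCD/HeatSlicedQuarks`, support item `DaviesGaffneyWilson` (U-uniform Davies–Gaffney
bound for the Wilson heat kernel `e^{-t D_W† D_W}`).  This file holds the abstract functional-analytic half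
of Davies' exponential-weight method:

* `norm_exp_smul_neg_apply_le` — Lumer–Phillips in a complex Hilbert space: if `Re ⟪v, T v⟫ ≥ -ω ‖v‖²`
  for all `v`, then `‖e^{-tT} v‖ ≤ e^{ω t} ‖v‖` for `t ≥ 0` (energy method: `s ↦ e^{-2ωs} ‖e^{-sT} v‖²`
  is non-increasing).
* `opNorm_toEuclideanCLM_exp_le` — the same for a complex square matrix `B` and the matrix exponential
  `NormedSpace.exp (-(t : ℂ) • B)`, in the `ℓ²` operator norm (through `Matrix.toEuclideanCLM`).
* `norm_entry_le_opNorm_toEuclideanCLM` — an entry is bounded by the `ℓ²` operator norm.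
* `star_dotProduct_mulVec_eq_sum`, `re_term_symm`, `sum_sum_mul_mul_le` — finite-sum bookkeeping for
  quadratic forms (expansion, Hermitian symmetry of the summands, an AM–GM/Schur bound).

No named facts; Mathlib only.
-/

noncomputable section

namespace Summit.QuantumFields.QCD.Theorems.HeatSlicedQuarksDaviesGaffney

open scoped InnerProductSpace ComplexConjugate
open NormedSpace

section Hilbert

variable {E : Type*} [NormedAddCommGroup E] [InnerProductSpace ℂ E] [CompleteSpace E]

/-- **Lumer–Phillips bound (complex Hilbert space).**  If a bounded operator `T` satisfies
`Re ⟪v, T v⟫ ≥ -ω‖v‖²` for every `v`, then the semigroup `e^{-tT} = exp ((t : ℂ) • (-T))` obeys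
`‖e^{-tT} v‖ ≤ e^{ωt} ‖v‖` for all `t ≥ 0`.  Proof: with `u(s) = e^{-sT} v` one has
`d/ds ‖u‖² = -2 Re⟪u, T u⟫ ≤ 2ω ‖u‖²`, so `e^{-2ωs}‖u(s)‖²` is non-increasing. -/
theorem norm_exp_smul_neg_apply_le (T : E →L[ℂ] E) {ω : ℝ}
    (hT : ∀ v : E, -(ω * ‖v‖ ^ 2) ≤ (⟪v, T v⟫_ℂ).re) (v : E) {t : ℝ} (ht : 0 ≤ t) :
    ‖exp ((t : ℂ) • (-T)) v‖ ≤ Real.exp (ω * t) * ‖v‖ := by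
  letI : InnerProductSpace ℝ E := InnerProductSpace.complexToReal
  -- the trajectory `u s = e^{-sT} v` and its derivative
  set u : ℝ → E := fun s => exp ((s : ℂ) • (-T)) v with hu_def
  have huC : ∀ z : ℂ, HasDerivAt (fun z : ℂ => exp (z • (-T)) v) ((-T) (exp (z • (-T)) v)) z := by
    intro z
    have h1 := (hasDerivAt_exp_smul_const' (𝕂 := ℂ) (-T) z).clm_apply (hasDerivAt_const z v)
    simpa using h1
  have hu : ∀ s : ℝ, HasDerivAt u ((-T) (u s)) s := by
    intro s
    have := (huC (s : ℂ)).scomp s (Complex.ofRealCLM.hasDerivAt)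
    simpa [u, Function.comp_def] using this
  -- the energy `‖u s‖²` and its derivative
  have hφ : ∀ s, HasDerivAt (fun s => ‖u s‖ ^ 2) (2 * ⟪u s, (-T) (u s)⟫_ℝ) s := fun s => (hu s).norm_sq
  have hφ_le : ∀ s, 2 * ⟪u s, (-T) (u s)⟫_ℝ ≤ 2 * ω * ‖u s‖ ^ 2 := by
    intro s
    have h1 : ⟪u s, (-T) (u s)⟫_ℝ = (⟪u s, (-T) (u s)⟫_ℂ).re := rfl
    rw [h1, neg_apply, inner_neg_right, Complex.neg_re]
    have := hT (u s)
    linarith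
  -- `ψ s = e^{-2ωs} ‖u s‖²` is non-increasing
  set ψ : ℝ → ℝ := fun s => Real.exp (-(2 * ω) * s) * ‖u s‖ ^ 2 with hψ_def
  have hψ : ∀ s, HasDerivAt ψ (Real.exp (-(2 * ω) * s) * (-(2 * ω)) * ‖u s‖ ^ 2
      + Real.exp (-(2 * ω) * s) * (2 * ⟪u s, (-T) (u s)⟫_ℝ)) s := by
    intro s
    have hl : HasDerivAt (fun s : ℝ => -(2 * ω) * s) (-(2 * ω)) s := by
      simpa using (hasDerivAt_id s).const_mul (-(2 * ω))
    exact (HasDerivAt.exp hl).mul (hφ s)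
  have hψ' : Antitone ψ := by
    refine antitone_of_deriv_nonpos (fun s => (hψ s).differentiableAt) fun s => ?_
    rw [(hψ s).deriv]
    have hpos : 0 < Real.exp (-(2 * ω) * s) := Real.exp_pos _
    nlinarith [hφ_le s, hpos]
  have h0 : u 0 = v := by simp [u]
  have key : Real.exp (-(2 * ω) * t) * ‖u t‖ ^ 2 ≤ ‖v‖ ^ 2 := by
    have := hψ' ht
    simpa [ψ, h0] using this
  have hexp : Real.exp (ω * t) ^ 2 = Real.exp (2 * ω * t) := by
    rw [sq, ← Real.exp_add]; ring_nf
  have hE : Real.exp (2 * ω * t) * Real.exp (-(2 * ω) * t) = 1 := by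
    rw [← Real.exp_add]; ring_nf; simp
  have key2 : ‖u t‖ ^ 2 ≤ (Real.exp (ω * t) * ‖v‖) ^ 2 := by
    rw [mul_pow, hexp]
    calc ‖u t‖ ^ 2 = Real.exp (2 * ω * t) * (Real.exp (-(2 * ω) * t) * ‖u t‖ ^ 2) := by
          rw [← mul_assoc, hE, one_mul]
      _ ≤ Real.exp (2 * ω * t) * ‖v‖ ^ 2 := by gcongr
  exact (pow_le_pow_iff_left₀ (norm_nonneg _) (by positivity) two_ne_zero).mp key2

/-- Operator-norm form of `norm_exp_smul_neg_apply_le`: `‖e^{-tT}‖ ≤ e^{ωt}` for `t ≥ 0` when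
`Re ⟪v, T v⟫ ≥ -ω‖v‖²`. -/
theorem opNorm_exp_smul_neg_le (T : E →L[ℂ] E) {ω : ℝ}
    (hT : ∀ v : E, -(ω * ‖v‖ ^ 2) ≤ (⟪v, T v⟫_ℂ).re) {t : ℝ} (ht : 0 ≤ t) :
    ‖exp ((t : ℂ) • (-T))‖ ≤ Real.exp (ω * t) :=
  ContinuousLinearMap.opNorm_le_bound _ (by positivity) fun v =>
    norm_exp_smul_neg_apply_le T hT v ht

end Hilbert

section Matrix

variable {ι : Type*} [Fintype ι] [DecidableEq ι]

/-- The matrix exponential is carried to the operator exponential by `Matrix.toEuclideanCLM`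
(a continuous algebra isomorphism). -/
theorem toEuclideanCLM_exp (X : Matrix ι ι ℂ) :
    Matrix.toEuclideanCLM (𝕜 := ℂ) (n := ι) (exp X) =
      exp (Matrix.toEuclideanCLM (𝕜 := ℂ) (n := ι) X) := by
  open scoped Matrix.Norms.L2Operator in
  letI : NormedAlgebra ℚ (Matrix ι ι ℂ) := .restrictScalars ℚ ℂ _
  letI : NormedAlgebra ℚ (EuclideanSpace ℂ ι →L[ℂ] EuclideanSpace ℂ ι) := .restrictScalars ℚ ℂ _
  refine map_exp (Matrix.toEuclideanCLM (𝕜 := ℂ) (n := ι)) ?_ X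
  exact AddMonoidHomClass.continuous_of_bound _ 1
    (fun A => by simp [Matrix.l2_opNorm_toEuclideanCLM])

/-- The quadratic form of a matrix through `toEuclideanCLM`: `⟪v, B v⟫ = v† B v`. -/
theorem inner_toEuclideanCLM_eq (B : Matrix ι ι ℂ) (v : EuclideanSpace ℂ ι) :
    ⟪v, Matrix.toEuclideanCLM (𝕜 := ℂ) (n := ι) B v⟫_ℂ =
      star (WithLp.ofLp v) ⬝ᵥ B.mulVec (WithLp.ofLp v) := by
  rw [EuclideanSpace.inner_eq_star_dotProduct, Matrix.ofLp_toEuclideanCLM, dotProduct_comm]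

/-- **Lumer–Phillips for matrices** (`ℓ²` operator norm): if `Re (v† B v) ≥ -ω Σ_i |v_i|²` for all
`v : ι → ℂ`, then `‖e^{-tB}‖_{ℓ² → ℓ²} ≤ e^{ωt}` for `t ≥ 0`, the matrix exponential being Mathlib's
`NormedSpace.exp (-(t : ℂ) • B)` and the norm taken through `Matrix.toEuclideanCLM`. -/
theorem opNorm_toEuclideanCLM_exp_le (B : Matrix ι ι ℂ) {ω : ℝ}
    (hB : ∀ v : ι → ℂ, -(ω * ∑ i, ‖v i‖ ^ 2) ≤ (star v ⬝ᵥ B.mulVec v).re) {t : ℝ} (ht : 0 ≤ t) :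
    ‖Matrix.toEuclideanCLM (𝕜 := ℂ) (n := ι) (exp (-(t : ℂ) • B))‖ ≤ Real.exp (ω * t) := by
  set T := Matrix.toEuclideanCLM (𝕜 := ℂ) (n := ι) B with hT_def
  have h1 : Matrix.toEuclideanCLM (𝕜 := ℂ) (n := ι) (exp (-(t : ℂ) • B)) = exp ((t : ℂ) • (-T)) := by
    rw [toEuclideanCLM_exp, map_smul, smul_neg, ← neg_smul]
  rw [h1]
  refine opNorm_exp_smul_neg_le T (fun v => ?_) ht
  rw [hT_def, inner_toEuclideanCLM_eq, EuclideanSpace.norm_sq_eq]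
  exact hB _

/-- An entry of a complex matrix is bounded by its `ℓ²` operator norm. -/
theorem norm_entry_le_opNorm_toEuclideanCLM (M : Matrix ι ι ℂ) (i j : ι) :
    ‖M i j‖ ≤ ‖Matrix.toEuclideanCLM (𝕜 := ℂ) (n := ι) M‖ := by
  set T := Matrix.toEuclideanCLM (𝕜 := ℂ) (n := ι) M with hT_def
  set e : EuclideanSpace ℂ ι := WithLp.toLp 2 (Pi.single j (1 : ℂ)) with he_def
  have h1 : M i j = WithLp.ofLp (T e) i := by
    rw [hT_def, he_def, Matrix.toEuclideanCLM_toLp, WithLp.ofLp_toLp, Matrix.mulVec_single_one,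
      Matrix.col_apply]
  rw [h1]
  calc ‖WithLp.ofLp (T e) i‖
      ≤ ‖T e‖ := PiLp.norm_apply_le _ i
    _ ≤ ‖T‖ * ‖e‖ := T.le_opNorm _
    _ = ‖T‖ := by rw [he_def, PiLp.toLp_single, PiLp.norm_single, norm_one, mul_one]

end Matrix

section General

variable {ι : Type*} [Fintype ι]

/-- The quadratic form of a matrix, expanded: `v† M v = Σ_i Σ_j v̄_i M_{ij} v_j`. -/
theorem star_dotProduct_mulVec_eq_sum (M : Matrix ι ι ℂ) (v : ι → ℂ) :
    star v ⬝ᵥ M.mulVec v = ∑ i, ∑ j, star (v i) * M i j * v j := by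
  simp only [dotProduct, Matrix.mulVec, Pi.star_apply, Finset.mul_sum, mul_assoc]

omit [Fintype ι] in
/-- For a Hermitian matrix the summands `Re(v̄_i A_{ij} v_j)` are symmetric in `(i, j)`. -/
theorem re_term_symm {A : Matrix ι ι ℂ} (hA : A.IsHermitian) (v : ι → ℂ) (i j : ι) :
    (star (v j) * A j i * v i).re = (star (v i) * A i j * v j).re := by
  have h : A j i = star (A i j) := by rw [← hA.apply i j, star_star]
  rw [h]
  have : star (v j) * star (A i j) * v i = star (star (v i) * A i j * v j) := by
    simp only [star_mul, star_star, mul_assoc]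
  rw [this, Complex.star_def, Complex.conj_re]

/-- AM–GM / Schur bound: for non-negative symmetric-in-effect coefficients `b` with row and column
sums at most `β`, `Σ_{ij} b_{ij} a_i a_j ≤ β Σ_i a_i²`. -/
theorem sum_sum_mul_mul_le {b : ι → ι → ℝ} (hb : ∀ i j, 0 ≤ b i j) {β : ℝ}
    (hrow : ∀ i, ∑ j, b i j ≤ β) (hcol : ∀ j, ∑ i, b i j ≤ β) (a : ι → ℝ) :
    ∑ i, ∑ j, b i j * (a i * a j) ≤ β * ∑ i, a i ^ 2 := by
  have h1 : ∀ i j, b i j * (a i * a j) ≤ b i j * a i ^ 2 / 2 + b i j * a j ^ 2 / 2 := fun i j => by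
    have := mul_le_mul_of_nonneg_left
      (show a i * a j ≤ (a i ^ 2 + a j ^ 2) / 2 by nlinarith [two_mul_le_add_sq (a i) (a j)]) (hb i j)
    linarith
  have h2 : ∑ i, ∑ j, b i j * a i ^ 2 / 2 = (∑ i, a i ^ 2 * ∑ j, b i j) / 2 := by
    rw [Finset.sum_div]
    refine Finset.sum_congr rfl fun i _ => ?_
    rw [Finset.mul_sum, Finset.sum_div]
    exact Finset.sum_congr rfl fun j _ => by ring
  have h3 : ∑ i, ∑ j, b i j * a j ^ 2 / 2 = (∑ j, a j ^ 2 * ∑ i, b i j) / 2 := by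
    rw [Finset.sum_comm, Finset.sum_div]
    refine Finset.sum_congr rfl fun j _ => ?_
    rw [Finset.mul_sum, Finset.sum_div]
    exact Finset.sum_congr rfl fun i _ => by ring
  have h4 : ∑ i, a i ^ 2 * ∑ j, b i j ≤ ∑ i, a i ^ 2 * β :=
    Finset.sum_le_sum fun i _ => mul_le_mul_of_nonneg_left (hrow i) (sq_nonneg _)
  have h5 : ∑ j, a j ^ 2 * ∑ i, b i j ≤ ∑ j, a j ^ 2 * β :=
    Finset.sum_le_sum fun j _ => mul_le_mul_of_nonneg_left (hcol j) (sq_nonneg _)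
  calc ∑ i, ∑ j, b i j * (a i * a j)
      ≤ ∑ i, ∑ j, (b i j * a i ^ 2 / 2 + b i j * a j ^ 2 / 2) :=
        Finset.sum_le_sum fun i _ => Finset.sum_le_sum fun j _ => h1 i j
    _ = (∑ i, a i ^ 2 * ∑ j, b i j) / 2 + (∑ j, a j ^ 2 * ∑ i, b i j) / 2 := by
        rw [← h2, ← h3, ← Finset.sum_add_distrib]
        exact Finset.sum_congr rfl fun i _ => Finset.sum_add_distrib
    _ ≤ (∑ i, a i ^ 2 * β) / 2 + (∑ j, a j ^ 2 * β) / 2 := by linarith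
    _ = β * ∑ i, a i ^ 2 := by rw [← Finset.sum_mul]; ring

end General

end Summit.QuantumFields.QCD.Theorems.HeatSlicedQuarksDaviesGaffney
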